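import Summits.Schanuel.Schanuel.Theorems.RootDecomp1BAlgFrame06

/-!
# RootDecomp1BAlgFrame — lens 4, generation 40 «UNBOUNDED-DEGREE FRAMES» (lane B-R24 (b′), PRICE B-β, RULE B-R26): X(2) and the three At-cells at (1 | ρ) for every ρ in the class `AlgUltraLiouville` (doubly-exponential hyper-approximation by real algebraic irrationals of UNBOUNDED degree) modulo `Roy2014_thm_1_1` ONLY — the degree a running parameter of Roy's point-explicit L–W measure (budget lemma `algFrameMeasure_explicit_of_roy` with the floor exp(−royC D·exp(A^8)·(1+log H)) in its TYPE); the NAMED MEMBER ρ_A (a tower over 2^{1/p}, prime degrees p → ∞) with HYPOTHESIS-FREE membership, degree certificate [ℚ(β_K):ℚ] = g_K, position certificate |ρ_A − γ| ≥ exp(−A⁴) and the exclusions BY TREE NAMES (¬Hyper, ¬QuadHyper, ¬Ultra ×2, ¬LiouvilleOrder 8, transcendental) — continuation (RootDecomp1BAlgFrame07): §M.8–§M.9 frame bound, tower inequality, scale selection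

(lens-4 g40 HOME kernel AlgFrame.lean fe3f4606…, 1974 l, imports tree RootDecomp1BQuadFrame05 + RootDecomp1EPointTransfer04 only; CLAIM L2078, RULING + CHECKLIST B-g40 L2080, NODE L2101 / REQUEST L2102 / RESULT L2103, critic VERDICT L2111 (crit g9: (A) CLEARED — ONE CELL (B-β); lens-4 tally THEOREM ×6 + CELL ×3; RULE B-R26 in force (the Roy-transfer line on 1B CLOSED); PORT GO 01–09 `--supports stmt-Schanuel-24622`); port by census-1 gen 18 as `RootDecomp1BAlgFrame01`–`09` along K's sections: 01 = §D the class `AlgUltraLiouville` + the measure shape `AlgFrameMeasure` + §R helpers (`royC`); 02 = §R the budget lemma `algFrameMeasure_explicit_of_roy` (Roy ⟹ the algebraic frame measure in EVERY degree; scoped `maxHeartbeats 1600000` carried as in K); 03 = §E the engine `algebraicIndependent_exp_frame_of_algUltraLiouville (hRoy)` + the `![…]` forms; 04 = §M.1–§M.3 prime degrees `gdeg`, radicals `theta`, frame data `Nseq`/`Pseq`/`fd` (with `attribute [irreducible] fd`), `betaSeq`, `fSeq`, `ASeq`, growth; 05 = §M.4–§M.5 increments, the limit `rhoA`, MEMBERSHIP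 `algUltraLiouville_rhoA`; 06 = §M.6–§M.7 degree certificate `finrank_adjoin_theta` / `adjoin_betaSeq_eq` + the number-field Liouville inequality (`FK`, `thetaF`, `sigma0`, norm to ℚ); 07 = §M.8–§M.9 the frame bound, the tower inequality, scale selection, `cert_arith`; 08 = §M.10–§M.11 THE POSITION CERTIFICATE `rhoA_far_from_degree_le` + EXCLUSIONS by tree names (`not_hyperLiouville_rhoA`, `not_quadHyperLiouville_rhoA`, `not_ultraLiouville_rhoA` / `'`, `not_liouvilleOrder_rhoA`, `transcendental_rhoA`); 09 = §C the cells `four_le_polarDeg_one_of_algUltra (hRoy)` (+ swap), the At-cells, the member cells at ρ_A, `rhoA_position`.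
PORT EDITS: the three `set_option linter.*` lines dropped and the one surfaced `unnecessarySimpa` fixed (`simpa using h12` ↦ `simp`, §R); 74 one-line docstrings added; two generic helpers made `private` (`three_mul_le_two_pow`, `half_identity`) with per-part private copies of those and of K's own private helpers; statements and proofs verbatim. `--supports stmt-Schanuel-24622`; no census credit carried; rung 0 — nothing here proves Schanuel.)
-/

noncomputable section

open Complex IntermediateField MvPolynomial

namespace Summit.Schanuel.Schanuel.Theorems.RootDecomp1BAlgFrame

open Summit.Schanuel.Schanuel.Theorems.RootDecomp1EPointTransfer (Roy2014_thm_1_1)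
open Summit.Schanuel.Schanuel.Theorems.RootDecomp1KHyper (mvlen mvlen_nonneg abs_coeff_le_mvlen one_le_mvlen)
open Summit.Schanuel.Schanuel.Theorems.RootDecomp1BHyperFrame (royDeg royS RoyNF roy_tree_iff framePt Ff
  Ff_eq_aeval exists_lipschitz_Ff linearIndependent_one_irrational)
open Summit.Schanuel.Schanuel.Theorems.RootDecomp1BQuadFrame (qy qe qpt qpt_apply framePt_qy_qe linearIndependent_qpt
  QuadHyperLiouville)
open Summit.Schanuel.Schanuel.Theorems.RootDecomp1BFedFlagCore (KleinIH polarDeg polarField)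
open Summit.Schanuel.Schanuel.Theorems.RootDecomp1BDefectFloorDefs (SharpRelativeLindemannAt TameDefectZeroAt
  WildSharpDefectZeroAt WildSharpDefectZeroInitAt WildSharpInitAt)
open Summit.Schanuel.Schanuel.Theorems.RootDecomp1BDefectFloorCells (natCast_le_trdeg_of_algebraicIndependent)
open Summit.Schanuel.Schanuel.Theorems.RootDecomp1BRadicalDescent (exists_int_relation)
open Summit.Schanuel.Schanuel.Theorems.RootDecomp1BMovingZero (mem_polarField_one mem_polarField_swap)

section Member

/-! ### §M.8 the frame bound `|β_K − γ| ≥ 1/B^{e}` for algebraic `γ` of degree `< g_K` -/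

/-- Lipschitz bound for integer polynomials on `[-2, 2]`. -/
theorem abs_aeval_sub_aeval_le {h : Polynomial ℤ} {d : ℕ} (hdeg : h.natDegree ≤ d) {A : ℕ}
    (hA : ∀ i, |h.coeff i| ≤ (A : ℤ)) {x y : ℝ} (hx : |x| ≤ 2) (hy : |y| ≤ 2) :
    |Polynomial.aeval x h - Polynomial.aeval y h| ≤ ((A * (d + 1) ^ 2 * 2 ^ d : ℕ) : ℝ) * |x - y| := by
  rw [Polynomial.aeval_eq_sum_range' (Nat.lt_succ_of_le hdeg) x,
    Polynomial.aeval_eq_sum_range' (Nat.lt_succ_of_le hdeg) y, ← Finset.sum_sub_distrib]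
  refine (Finset.abs_sum_le_sum_abs _ _).trans ?_
  have hterm : ∀ i ∈ Finset.range (d + 1),
      |h.coeff i • x ^ i - h.coeff i • y ^ i| ≤ (A : ℝ) * ((d : ℝ) * 2 ^ d) * |x - y| := by
    intro i hi
    rw [Finset.mem_range] at hi
    rw [← smul_sub, Algebra.smul_def, abs_mul, eq_intCast]
    have hc : |(h.coeff i : ℝ)| ≤ A := by exact_mod_cast hA i
    have hp : |x ^ i - y ^ i| ≤ |x - y| * i * max |x| |y| ^ (i - 1) := abs_pow_sub_pow_le x y i
    have hmax : max |x| |y| ≤ 2 := max_le hx hy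
    have hmax0 : 0 ≤ max |x| |y| := le_max_of_le_left (abs_nonneg x)
    have h2 : max |x| |y| ^ (i - 1) ≤ (2 : ℝ) ^ d :=
      (pow_le_pow_left₀ hmax0 hmax _).trans (pow_le_pow_right₀ (by norm_num) (by omega))
    have hi' : (i : ℝ) ≤ d := by exact_mod_cast (by omega : i ≤ d)
    have hxy : 0 ≤ |x - y| := abs_nonneg _
    have h3 : |x ^ i - y ^ i| ≤ (d : ℝ) * 2 ^ d * |x - y| := by
      calc |x ^ i - y ^ i| ≤ |x - y| * i * max |x| |y| ^ (i - 1) := hp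
        _ ≤ |x - y| * d * (2 : ℝ) ^ d :=
            mul_le_mul (mul_le_mul_of_nonneg_left hi' hxy) h2 (by positivity) (by positivity)
        _ = (d : ℝ) * 2 ^ d * |x - y| := by ring
    calc |(h.coeff i : ℝ)| * |x ^ i - y ^ i| ≤ A * ((d : ℝ) * 2 ^ d * |x - y|) :=
          mul_le_mul hc h3 (abs_nonneg _) (by positivity)
      _ = (A : ℝ) * ((d : ℝ) * 2 ^ d) * |x - y| := by ring
  calc ∑ i ∈ Finset.range (d + 1), |h.coeff i • x ^ i - h.coeff i • y ^ i|
      ≤ ∑ i ∈ Finset.range (d + 1), (A : ℝ) * ((d : ℝ) * 2 ^ d) * |x - y| := Finset.sum_le_sum hterm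
    _ = ((A : ℝ) * (d + 1) * 2 ^ d * |x - y|) * d := by
        rw [Finset.sum_const, Finset.card_range, nsmul_eq_mul]; push_cast; ring
    _ ≤ ((A : ℝ) * (d + 1) * 2 ^ d * |x - y|) * (d + 1) :=
        mul_le_mul_of_nonneg_left (by linarith) (by positivity)
    _ = ((A * (d + 1) ^ 2 * 2 ^ d : ℕ) : ℝ) * |x - y| := by push_cast; ring

/-- `3n ≤ 2^n` for `n ≥ 4`. -/
private theorem three_mul_le_two_pow {n : ℕ} (hn : 4 ≤ n) : 3 * n ≤ 2 ^ n := by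
  induction n, hn using Nat.le_induction with
  | base => norm_num
  | succ m hm ih => rw [pow_succ]; omega

/-- The arithmetic of the frame bound: `Lip · a^d · M^g ≤ (4aA)^{(2d+2)(g+1)}`. -/
theorem frame_arith {a A d g : ℕ} (ha : 2 ≤ a) (hA : 1 ≤ A) :
    A * (d + 1) ^ 2 * 2 ^ d * (a ^ d * ((d + 1) * (A * a ^ d) * (2 * a) ^ d) ^ g)
      ≤ (4 * a * A) ^ ((2 * d + 2) * (g + 1)) := by
  set B := 4 * a * A with hB
  have hB8 : 2 * 2 * 2 ≤ B := by rw [hB]; nlinarith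
  have hBA : A ≤ B := by rw [hB]; nlinarith
  have hBa : a ≤ B := by rw [hB]; nlinarith
  have hB2a : 2 * a ≤ B := by rw [hB]; nlinarith
  have hB1 : 1 ≤ B := by omega
  have h1 : d + 1 ≤ 2 ^ d := Nat.lt_two_pow_self
  have L2 : A * (d + 1) ^ 2 * 2 ^ d ≤ B ^ (d + 1) := by
    calc A * (d + 1) ^ 2 * 2 ^ d ≤ A * (2 ^ d) ^ 2 * 2 ^ d :=
          Nat.mul_le_mul (Nat.mul_le_mul le_rfl (Nat.pow_le_pow_left h1 2)) le_rfl
      _ = A * (2 * 2 * 2) ^ d := by rw [mul_pow, mul_pow]; ring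
      _ ≤ B * B ^ d := Nat.mul_le_mul hBA (Nat.pow_le_pow_left hB8 d)
      _ = B ^ (d + 1) := by ring
  have L3 : a ^ d ≤ B ^ d := Nat.pow_le_pow_left hBa d
  have L4 : (d + 1) * (A * a ^ d) * (2 * a) ^ d ≤ B ^ (2 * d + 1) := by
    calc (d + 1) * (A * a ^ d) * (2 * a) ^ d ≤ 2 ^ d * (A * a ^ d) * (2 * a) ^ d :=
          Nat.mul_le_mul (Nat.mul_le_mul h1 le_rfl) le_rfl
      _ = A * ((2 * a) ^ d * (2 * a) ^ d) := by rw [mul_pow]; ring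
      _ = A * (2 * a) ^ (2 * d) := by rw [← pow_add, ← two_mul]
      _ ≤ B * B ^ (2 * d) := Nat.mul_le_mul hBA (Nat.pow_le_pow_left hB2a _)
      _ = B ^ (2 * d + 1) := by ring
  have L5 : ((d + 1) * (A * a ^ d) * (2 * a) ^ d) ^ g ≤ B ^ ((2 * d + 1) * g) := by
    rw [pow_mul]; exact Nat.pow_le_pow_left L4 g
  have hexp : d + 1 + (d + (2 * d + 1) * g) ≤ (2 * d + 2) * (g + 1) := by nlinarith
  calc A * (d + 1) ^ 2 * 2 ^ d * (a ^ d * ((d + 1) * (A * a ^ d) * (2 * a) ^ d) ^ g)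
      ≤ B ^ (d + 1) * (B ^ d * B ^ ((2 * d + 1) * g)) := Nat.mul_le_mul L2 (Nat.mul_le_mul L3 L5)
    _ = B ^ (d + 1 + (d + (2 * d + 1) * g)) := by rw [← pow_add, ← pow_add]
    _ ≤ B ^ ((2 * d + 2) * (g + 1)) := Nat.pow_le_pow_right hB1 hexp

/-- **THE FRAME BOUND.** For `γ` a root of `h ∈ ℤ[X]` (`h ≠ 0`, `deg h ≤ d < g_K`, `|h_i| ≤ A`, `A ≥ 1`):
`|β_K − γ| ≥ 1 / (4 a_K A)^{(2d+2)(g_K+1)}`. -/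
theorem frame_bound {K d A : ℕ} (hdg : d < gdeg K) {h : Polynomial ℤ} (hh : h ≠ 0)
    (hdeg : h.natDegree ≤ d) (hA : ∀ i, |h.coeff i| ≤ (A : ℤ)) (hA1 : 1 ≤ A) {γ : ℝ}
    (hγ : Polynomial.aeval γ h = 0) :
    1 / (((4 * aN K * A : ℕ) : ℝ) ^ ((2 * d + 2) * (gdeg K + 1))) ≤ |betaSeq K - γ| := by
  have hApos : 0 < A := hA1
  have haNp : 0 < aN K := aN_pos K
  have hBN : 1 ≤ 4 * aN K * A := by nlinarith
  have hB1 : (1 : ℝ) ≤ ((4 * aN K * A : ℕ) : ℝ) := by exact_mod_cast hBN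
  by_cases hfar : 1 ≤ |betaSeq K - γ|
  · refine le_trans ?_ hfar
    rw [div_le_one (by positivity)]
    exact one_le_pow₀ hB1
  push Not at hfar
  have hβ2 : |betaSeq K| ≤ 2 := by
    rw [abs_of_pos (betaSeq_pos K)]; linarith [betaSeq_lt K]
  have hγ2 : |γ| ≤ 2 := by
    have h1 := abs_sub_abs_le_abs_sub γ (betaSeq K)
    rw [abs_sub_comm γ] at h1
    have := betaSeq_lt K
    have := betaSeq_pos K
    rw [abs_of_pos (betaSeq_pos K)] at h1
    linarith
  -- Lipschitz + Liouville
  have hlip := abs_aeval_sub_aeval_le hdeg hA hβ2 hγ2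
  rw [hγ, sub_zero] at hlip
  have hliou := liouville_betaSeq hdg hh hdeg hA
  have hLpos : (0 : ℝ) < ((A * (d + 1) ^ 2 * 2 ^ d : ℕ) : ℝ) := by
    exact_mod_cast Nat.mul_pos (Nat.mul_pos hA1 (by positivity)) (by positivity)
  have hXpos : (0 : ℝ) < (aN K : ℝ) ^ d *
      (((d : ℝ) + 1) * ((A * aN K ^ d : ℕ) : ℝ) * (2 * (aN K : ℝ)) ^ d) ^ gdeg K := by
    have := aNR_pos K; positivity
  -- `1/(Lip · X) ≤ |β − γ|`
  have key : 1 / (((A * (d + 1) ^ 2 * 2 ^ d : ℕ) : ℝ) * ((aN K : ℝ) ^ d *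
      (((d : ℝ) + 1) * ((A * aN K ^ d : ℕ) : ℝ) * (2 * (aN K : ℝ)) ^ d) ^ gdeg K)) ≤ |betaSeq K - γ| := by
    rw [mul_comm, ← div_div]
    exact (div_le_iff₀' hLpos).mpr (hliou.trans hlip)
  refine le_trans ?_ key
  apply one_div_le_one_div_of_le (by positivity)
  have hfa := frame_arith (d := d) (g := gdeg K) (le_trans (by norm_num) (le_aN K)) hA1
  have hfa' : ((A * (d + 1) ^ 2 * 2 ^ d * (aN K ^ d * ((d + 1) * (A * aN K ^ d) * (2 * aN K) ^ d) ^ gdeg K) : ℕ) : ℝ)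
      ≤ (((4 * aN K * A) ^ ((2 * d + 2) * (gdeg K + 1)) : ℕ) : ℝ) := by exact_mod_cast hfa
  push_cast at hfa' ⊢
  linarith [hfa']

/-! ### §M.9 the tower inequality and the scale selection -/

/-- `g_K + 1 ≤ 2 N_{K+1}`. -/
theorem gdeg_succ_le_two_mul_Nseq (K : ℕ) : gdeg K + 1 ≤ 2 * Nseq (K + 1) := by
  have := gdeg_le K; have := le_Nseq (K + 1); omega

/-- **THE TOWER INEQUALITY** (case II of the certificate): the level-`(K+1)` frame denominator is dwarfed by
`a_{K+2}`. -/
theorem tower {K d A : ℕ} (hd : d < gdeg K) (hA : A < aN (K + 1)) :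
    8 * (32 * A * (4 * aN K * A) ^ ((2 * d + 2) * (gdeg K + 1))) ^ ((2 * d + 2) * (gdeg (K + 1) + 1))
      ≤ aN (K + 2) := by
  set x := aN (K + 1) with hxdef
  set N := Nseq (K + 1) with hNdef
  set e1 := (2 * d + 2) * (gdeg K + 1) with he1def
  set e2 := (2 * d + 2) * (gdeg (K + 1) + 1) with he2def
  have hx : x = 2 ^ N := rfl
  have hN : K + 11 ≤ N := le_Nseq (K + 1)
  have haK : aN K ≤ x := aN_strictMono.monotone (Nat.le_succ K)
  have hx2 : 1024 ≤ x := le_aN (K + 1)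
  have hAx : A ≤ x := hA.le
  -- the inner quantity is at most `(4x²)^(e1+2)`, the whole at most `(4x²)^((e1+2)e2+1)`
  have hB : 4 * aN K * A ≤ 4 * x ^ 2 := by nlinarith
  have hx3 : 2 ≤ x ^ 3 := le_trans (by norm_num) (Nat.pow_le_pow_left (show 2 ≤ x by omega) 3)
  have h32 : 32 * A ≤ (4 * x ^ 2) ^ 2 := by
    calc 32 * A ≤ 32 * x := Nat.mul_le_mul_left _ hAx
      _ = 16 * x * 2 := by ring
      _ ≤ 16 * x * x ^ 3 := Nat.mul_le_mul_left _ hx3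
      _ = (4 * x ^ 2) ^ 2 := by ring
  have hinner : 32 * A * (4 * aN K * A) ^ e1 ≤ (4 * x ^ 2) ^ (e1 + 2) := by
    calc 32 * A * (4 * aN K * A) ^ e1 ≤ (4 * x ^ 2) ^ 2 * (4 * x ^ 2) ^ e1 :=
          Nat.mul_le_mul h32 (Nat.pow_le_pow_left hB e1)
      _ = (4 * x ^ 2) ^ (e1 + 2) := by rw [← pow_add, add_comm]
  have h8 : 8 ≤ 4 * x ^ 2 := by nlinarith
  have hΨ : 8 * (32 * A * (4 * aN K * A) ^ e1) ^ e2 ≤ (4 * x ^ 2) ^ ((e1 + 2) * e2 + 1) := by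
    calc 8 * (32 * A * (4 * aN K * A) ^ e1) ^ e2 ≤ (4 * x ^ 2) * ((4 * x ^ 2) ^ (e1 + 2)) ^ e2 :=
          Nat.mul_le_mul h8 (Nat.pow_le_pow_left hinner e2)
      _ = (4 * x ^ 2) ^ ((e1 + 2) * e2 + 1) := by rw [← pow_mul, ← pow_succ']
  have h4x : 4 * x ^ 2 = 2 ^ (2 * N + 2) := by rw [hx]; ring
  -- the exponent is polynomial in `N`
  have hd2 : 2 * d + 2 ≤ 4 * N := by have := gdeg_le K; omega
  have he1 : e1 ≤ 4 * N * (2 * N) := Nat.mul_le_mul hd2 (by have := gdeg_le K; omega)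
  have he2 : e2 ≤ 4 * N * (2 * N) := Nat.mul_le_mul hd2 (by have := gdeg_le (K + 1); omega)
  have hN11 : 11 ≤ N := by omega
  have hE1 : (e1 + 2) * e2 + 1 ≤ 81 * N ^ 4 := by
    have h1 : e1 + 2 ≤ 10 * N ^ 2 := by nlinarith
    have h2 : e2 ≤ 8 * N ^ 2 := by nlinarith
    calc (e1 + 2) * e2 + 1 ≤ 10 * N ^ 2 * (8 * N ^ 2) + 1 := by
          exact Nat.add_le_add_right (Nat.mul_le_mul h1 h2) 1
      _ ≤ 81 * N ^ 4 := by nlinarith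
  have hE : (2 * N + 2) * ((e1 + 2) * e2 + 1) ≤ 243 * N ^ 5 := by
    calc (2 * N + 2) * ((e1 + 2) * e2 + 1) ≤ (3 * N) * (81 * N ^ 4) :=
          Nat.mul_le_mul (by omega) hE1
      _ = 243 * N ^ 5 := by ring
  -- and `N_{K+2}` is a tower in `A_{K+1} ≥ x = 2^N ≥ 3N`
  have hNK2 : 243 * N ^ 5 ≤ Nseq (K + 2) := by
    rw [Nseq_succ]
    have hAx' : x ≤ ASeq (K + 1) := aN_le_ASeq (K + 1)
    have h3N : 3 * N ≤ x := by rw [hx]; exact three_mul_le_two_pow (by omega)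
    have hA5 : 5 ≤ ASeq (K + 1) := by omega
    have h3A : ASeq (K + 1) < 3 ^ ASeq (K + 1) := Nat.lt_pow_self (by norm_num)
    have h1 : (ASeq (K + 1) + 1) ^ 5 ≤ 3 ^ (ASeq (K + 1) ^ (K + 2)) := by
      calc (ASeq (K + 1) + 1) ^ 5 ≤ (ASeq (K + 1) + 1) ^ ASeq (K + 1) :=
            Nat.pow_le_pow_right (by omega) hA5
        _ ≤ (3 ^ ASeq (K + 1)) ^ ASeq (K + 1) := Nat.pow_le_pow_left h3A _
        _ = 3 ^ (ASeq (K + 1) ^ 2) := by rw [← pow_mul, sq]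
        _ ≤ 3 ^ (ASeq (K + 1) ^ (K + 2)) :=
            Nat.pow_le_pow_right (by norm_num) (Nat.pow_le_pow_right (by omega) (by omega))
    calc 243 * N ^ 5 = (3 * N) ^ 5 := by ring
      _ ≤ x ^ 5 := Nat.pow_le_pow_left h3N 5
      _ ≤ (ASeq (K + 1) + 1) ^ 5 := Nat.pow_le_pow_left (by omega) 5
      _ ≤ 3 ^ (ASeq (K + 1) ^ (K + 2)) := h1
      _ ≤ 2 * 3 ^ (ASeq (K + 1) ^ (K + 1 + 1)) + 2 := by rw [show K + 1 + 1 = K + 2 by ring]; omega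
  calc 8 * (32 * A * (4 * aN K * A) ^ e1) ^ e2 ≤ (4 * x ^ 2) ^ ((e1 + 2) * e2 + 1) := hΨ
    _ = 2 ^ ((2 * N + 2) * ((e1 + 2) * e2 + 1)) := by rw [h4x, ← pow_mul]
    _ ≤ 2 ^ Nseq (K + 2) := Nat.pow_le_pow_right (by norm_num) (hE.trans hNK2)
    _ = aN (K + 2) := rfl

/-- Scale selection: for `A ≥ a_{d+1}` there is `K ≥ d + 1` with `a_K ≤ A < a_{K+1}`. -/
theorem exists_scale {d A : ℕ} (hA : aN (d + 1) ≤ A) :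
    ∃ K, d + 1 ≤ K ∧ aN K ≤ A ∧ A < aN (K + 1) := by
  classical
  have hex : ∃ K, A < aN (K + 1) := by
    refine ⟨A, ?_⟩
    calc A < 2 ^ A := Nat.lt_two_pow_self
      _ ≤ 2 ^ Nseq (A + 1) := Nat.pow_le_pow_right (by norm_num) (by have := le_Nseq (A + 1); omega)
      _ = aN (A + 1) := rfl
  refine ⟨Nat.find hex, ?_, ?_, Nat.find_spec hex⟩
  · by_contra hlt
    push Not at hlt
    have h1 : aN (Nat.find hex + 1) ≤ aN (d + 1) := aN_strictMono.monotone (by omega)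
    have h2 := Nat.find_spec hex
    omega
  · have h0 : 0 < Nat.find hex := by
      rw [Nat.pos_iff_ne_zero]
      intro h0
      have h2 := Nat.find_spec hex
      rw [h0] at h2
      have h1 : aN (0 + 1) ≤ aN (d + 1) := aN_strictMono.monotone (by omega)
      omega
    have hmin := Nat.find_min hex (show Nat.find hex - 1 < Nat.find hex by omega)
    rw [show Nat.find hex - 1 + 1 = Nat.find hex by omega] at hmin
    exact not_lt.mp hmin

/-- The arithmetic of the certificate: `2Ψ ≤ A^{27 D² A²}`. -/
theorem cert_arith {a A D g₁ g₂ : ℕ} (haA : a ≤ A) (hA : 4 ≤ A) (hD : 1 ≤ D) (hg₁ : g₁ ≤ 2 * A)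
    (hg₂ : g₂ ≤ 2 * A) :
    2 * (32 * A * (4 * a * A) ^ (D * g₁)) ^ (D * g₂) ≤ A ^ (27 * D ^ 2 * A ^ 2) := by
  set C := 4 * A ^ 2 with hC
  have hC1 : 1 ≤ C := by rw [hC]; nlinarith
  have hCa : 4 * a * A ≤ C := by rw [hC]; nlinarith
  have hA3 : 2 ≤ A ^ 3 := le_trans (by norm_num) (Nat.pow_le_pow_left (show 2 ≤ A by omega) 3)
  have h32 : 32 * A ≤ C ^ 2 := by
    calc 32 * A = 16 * A * 2 := by ring
      _ ≤ 16 * A * A ^ 3 := Nat.mul_le_mul_left _ hA3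
      _ = C ^ 2 := by rw [hC]; ring
  have h2C : 2 ≤ C := by rw [hC]; nlinarith
  have hCA : C ≤ A ^ 3 := by
    calc C = 4 * A * A := by rw [hC]; ring
      _ ≤ A * A * A := Nat.mul_le_mul_right _ (Nat.mul_le_mul_right _ hA)
      _ = A ^ 3 := by ring
  have hinner : 32 * A * (4 * a * A) ^ (D * g₁) ≤ C ^ (2 * D * A + 2) := by
    calc 32 * A * (4 * a * A) ^ (D * g₁) ≤ C ^ 2 * C ^ (D * g₁) :=
          Nat.mul_le_mul h32 (Nat.pow_le_pow_left hCa _)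
      _ ≤ C ^ 2 * C ^ (2 * D * A) :=
          Nat.mul_le_mul le_rfl (Nat.pow_le_pow_right hC1 (by nlinarith))
      _ = C ^ (2 * D * A + 2) := by rw [← pow_add, add_comm]
  have hexp : (2 * D * A + 2) * (2 * D * A) + 1 ≤ 9 * D ^ 2 * A ^ 2 := by
    have ht : 4 ≤ D * A := by nlinarith
    have e1 : (2 * D * A + 2) * (2 * D * A) + 1 = 4 * (D * A) * (D * A) + 4 * (D * A) + 1 := by ring
    have e2 : 9 * D ^ 2 * A ^ 2 = 9 * (D * A) * (D * A) := by ring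
    rw [e1, e2]
    nlinarith [Nat.mul_le_mul ht ht]
  calc 2 * (32 * A * (4 * a * A) ^ (D * g₁)) ^ (D * g₂)
      ≤ C * (C ^ (2 * D * A + 2)) ^ (D * g₂) := Nat.mul_le_mul h2C (Nat.pow_le_pow_left hinner _)
    _ ≤ C * (C ^ (2 * D * A + 2)) ^ (2 * D * A) :=
        Nat.mul_le_mul le_rfl (Nat.pow_le_pow_right (by positivity) (by nlinarith))
    _ = C ^ ((2 * D * A + 2) * (2 * D * A) + 1) := by rw [← pow_mul, ← pow_succ']
    _ ≤ C ^ (9 * D ^ 2 * A ^ 2) := Nat.pow_le_pow_right hC1 hexp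
    _ ≤ (A ^ 3) ^ (9 * D ^ 2 * A ^ 2) := Nat.pow_le_pow_left hCA _
    _ = A ^ (27 * D ^ 2 * A ^ 2) := by rw [← pow_mul]; ring_nf

/-- `1/(2t) = 1/t − 1/(2t)`. -/
private theorem half_identity {t : ℝ} (ht : 0 < t) : 1 / (2 * t) = 1 / t - 1 / (2 * t) := by
  field_simp; ring

end Member

end Summit.Schanuel.Schanuel.Theorems.RootDecomp1BAlgFrame

end
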